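import Mathlib
import Summits.NavierStokesRegularity.NavierStokesRegularity.Theses.LandauTail

/-!
# Osgood/Baire lemma for the Landau-tail blow-up scenario

Pointwise convergence (off the origin) of the parabolic rescalings
`v_t(y) := √(0-t) • u t (√(0-t) • y)` of a field `u` jointly continuous on `(-1,0) × ℝ³`
forces local uniform boundedness of the family `{v_t : t ∈ [-1/2, 0)}` on a dense
(automatically open) set of `y`. Pure topology (Baire category applied to the dense `Gδ`
set `{0}ᶜ ⊆ ℝ³`), no PDE.
-/

set_option linter.dupNamespace false

namespace Summit.NavierStokesRegularity.NavierStokesRegularity.Theorems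

open Set Filter Topology

/-- For `u` jointly continuous on `(-1,0) × ℝ³` and a fixed time `t ∈ (-1,0)`, the rescaled
slice `y ↦ √(0-t) • u t (√(0-t) • y)` is continuous on `ℝ³`. -/
theorem landauTail_rescaledSlice_continuous
    (u : ℝ → EuclideanSpace ℝ (Fin 3) → EuclideanSpace ℝ (Fin 3))
    (hu : ContinuousOn (Function.uncurry u) (Set.Ioo (-1 : ℝ) 0 ×ˢ Set.univ))
    {t : ℝ} (ht : t ∈ Set.Ioo (-1 : ℝ) 0) :
    Continuous fun y : EuclideanSpace ℝ (Fin 3) =>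
      Real.sqrt (0 - t) • u t (Real.sqrt (0 - t) • y) := by
  have h1 : Continuous (u t) :=
    hu.comp_continuous (continuous_const.prodMk continuous_id)
      fun y => Set.mk_mem_prod ht (Set.mem_univ y)
  have h2 : Continuous fun y : EuclideanSpace ℝ (Fin 3) => Real.sqrt (0 - t) • y :=
    continuous_const_smul (Real.sqrt (0 - t))
  exact Continuous.const_smul (h1.comp h2) (Real.sqrt (0 - t))

/-- For `u` jointly continuous on `(-1,0) × ℝ³` and a fixed `y`, the rescaled orbit
`t ↦ √(0-t) • u t (√(0-t) • y)` is continuous on `(-1,0)`. -/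
theorem landauTail_rescaledOrbit_continuousOn
    (u : ℝ → EuclideanSpace ℝ (Fin 3) → EuclideanSpace ℝ (Fin 3))
    (hu : ContinuousOn (Function.uncurry u) (Set.Ioo (-1 : ℝ) 0 ×ˢ Set.univ))
    (y : EuclideanSpace ℝ (Fin 3)) :
    ContinuousOn (fun t : ℝ => Real.sqrt (0 - t) • u t (Real.sqrt (0 - t) • y))
      (Set.Ioo (-1 : ℝ) 0) := by
  have hs : Continuous fun t : ℝ => Real.sqrt (0 - t) :=
    Real.continuous_sqrt.comp (continuous_const.sub continuous_id)
  have h1 : ContinuousOn (fun t : ℝ => u t (Real.sqrt (0 - t) • y)) (Set.Ioo (-1 : ℝ) 0) :=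
    hu.comp (continuousOn_id.prodMk (hs.smul continuous_const).continuousOn)
      fun t ht => Set.mk_mem_prod ht (Set.mem_univ _)
  exact hs.continuousOn.smul h1

/-- A function continuous on `(-1,0)` with a limit at `0⁻` is bounded on `[-1/2, 0)`
(by a natural number). -/
theorem landauTail_orbit_bounded_of_tendsto
    (g : ℝ → EuclideanSpace ℝ (Fin 3)) (L : EuclideanSpace ℝ (Fin 3))
    (hg : ContinuousOn g (Set.Ioo (-1 : ℝ) 0))
    (hL : Filter.Tendsto g (nhdsWithin 0 (Set.Iio 0)) (nhds L)) :
    ∃ N : ℕ, ∀ t ∈ Set.Ico (-1/2 : ℝ) 0, ‖g t‖ ≤ N := by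
  -- near `0⁻` the orbit is within `1` of its limit
  have hev : ∀ᶠ t in nhdsWithin 0 (Set.Iio 0), ‖g t‖ ≤ ‖L‖ + 1 :=
    (Metric.tendsto_nhds.mp hL 1 one_pos).mono fun t ht =>
      norm_le_norm_add_const_of_dist_le ht.le
  obtain ⟨a, ha, hsub⟩ := mem_nhdsLT_iff_exists_Ioo_subset.mp hev
  have ha' : a < 0 := ha
  -- on the compact `[-1/2, a]` the orbit is bounded by continuity
  obtain ⟨C, hC⟩ := (isCompact_Icc : IsCompact (Set.Icc (-1/2 : ℝ) a)).exists_bound_of_continuousOn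
    (hg.mono fun x hx => ⟨by linarith [hx.1], by linarith [hx.2]⟩)
  refine ⟨⌈max C (‖L‖ + 1)⌉₊, fun t ht => ?_⟩
  rcases le_or_gt t a with hta | hta
  · exact (hC t ⟨ht.1, hta⟩).trans ((le_max_left _ _).trans (Nat.le_ceil _))
  · have h1 : ‖g t‖ ≤ ‖L‖ + 1 := hsub ⟨hta, ht.2⟩
    exact h1.trans ((le_max_right _ _).trans (Nat.le_ceil _))

/-- **Osgood/Baire lemma (disprover-facing) for the Landau tail.** If `u` is jointly continuous
on `(-1,0) × ℝ³` and its parabolic rescalings `√(0-t) • u t (√(0-t) • y)` converge as `t → 0⁻`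
for every `y ≠ 0`, then the set of points `y` near which the family
`{√(0-t) • u t (√(0-t) • ·) : t ∈ [-1/2, 0)}` is uniformly bounded is dense in `ℝ³`.
Proof: the closed sets `F_N := {y | ∀ t ∈ [-1/2,0), ‖√(0-t) • u t (√(0-t) • y)‖ ≤ N}` cover the
dense `Gδ` set `{0}ᶜ` (each orbit is continuous with a limit at `0⁻`, hence bounded), so by Baire
`⋃ N, interior F_N` is dense, and it is contained in the target set. -/
theorem landauTail_tail_locUnifBdd_dense : ∀ (u : ℝ → EuclideanSpace ℝ (Fin 3) → EuclideanSpace ℝ (Fin 3)) (V : EuclideanSpace ℝ (Fin 3) → EuclideanSpace ℝ (Fin 3)), ContinuousOn (Function.uncurry u) (Set.Ioo (-1 : ℝ) 0 ×ˢ Set.univ) → (∀ y : EuclideanSpace ℝ (Fin 3), y ≠ 0 → Filter.Tendsto (fun t : ℝ => Real.sqrt (0 - t) • u t (Real.sqrt (0 - t) • y)) (nhdsWithin 0 (Set.Iio 0)) (nhds (V y))) → Dense {y : EuclideanSpace ℝ (Fin 3) | ∃ ρ : ℝ, 0 < ρ ∧ ∃ M : ℝ, ∀ t ∈ Set.Ico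 (-1/2 : ℝ) 0, ∀ z ∈ Metric.ball y ρ, ‖Real.sqrt (0 - t) • u t (Real.sqrt (0 - t) • z)‖ ≤ M} := by
  intro u V hu hlim
  -- the closed sets of the Baire argument
  set F : ℕ → Set (EuclideanSpace ℝ (Fin 3)) := fun N =>
    ⋂ (t : ℝ) (_ : t ∈ Set.Ico (-1/2 : ℝ) 0),
      {y : EuclideanSpace ℝ (Fin 3) | ‖Real.sqrt (0 - t) • u t (Real.sqrt (0 - t) • y)‖ ≤ (N : ℝ)}
    with hF_def
  have hF_closed : ∀ N, IsClosed (F N) := fun N =>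
    isClosed_iInter fun t => isClosed_iInter fun ht =>
      isClosed_le (landauTail_rescaledSlice_continuous u hu ⟨by linarith [ht.1], ht.2⟩).norm
        continuous_const
  -- they cover the punctured space
  have hcover : ({0}ᶜ : Set (EuclideanSpace ℝ (Fin 3))) ⊆ ⋃ N, F N := by
    intro y hy
    obtain ⟨N, hN⟩ := landauTail_orbit_bounded_of_tendsto _ (V y)
      (landauTail_rescaledOrbit_continuousOn u hu y) (hlim y (Set.mem_compl_singleton_iff.mp hy))
    refine Set.mem_iUnion.2 ⟨N, ?_⟩
    simp only [hF_def, Set.mem_iInter, Set.mem_setOf_eq]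
    exact hN
  -- Baire: the interiors are dense
  have hdense : Dense (⋃ N, interior (F N)) :=
    (isOpen_compl_singleton.isGδ).dense_iUnion_interior_of_closed (dense_compl_singleton 0)
      hF_closed hcover
  refine hdense.mono (Set.iUnion_subset fun N => ?_)
  intro y hy
  obtain ⟨ρ, hρ, hball⟩ := Metric.mem_nhds_iff.1 (mem_interior_iff_mem_nhds.1 hy)
  refine ⟨ρ, hρ, N, fun t ht z hz => ?_⟩
  have hz' := hball hz
  simp only [hF_def, Set.mem_iInter, Set.mem_setOf_eq] at hz'
  exact hz' t ht

end Summit.NavierStokesRegularity.NavierStokesRegularity.Theorems
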